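import Mathlib
import Summits.AtomisticToContinuum.FouriersLaw.Theses.JunctionLocality

/-!
# STRATEGY-CENSUS signatures — crux `SuperadditiveResistance` (stmt-AtomisticToContinuum-11748)

Typed forms of the Strengthen / Decomposition attempts recorded in `STRATEGY-CENSUS.md`
(crux-strategist wall-breaker seat, 2026-08-17).  Nothing here is filed as an item; the census cites
these declarations by name.  `sorry`-free.
-/

noncomputable section

open MeasureTheory Filter Topology
open Literature.MathematicalPhysics.KineticTheory.HeatConduction

namespace Summit.AtomisticToContinuum.FouriersLaw.Cruxes.SuperadditiveResistance.StrategyCensus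

/-! ## §0 The dynamical shell of the crux, with an abstract conclusion on the response sequence -/

/-- The crux's quantifier prefix (parameters, weak-NESS uniqueness, steady family, temperature,
response coefficients, positivity) applied to an arbitrary conclusion `P` about `D`. -/
def Shell (P : (ℕ → ℝ) → Prop) : Prop :=
  ∀ ω₂ lam β γ : ℝ, 0 < ω₂ → 0 < lam → 0 < β → 0 < γ →
    (∀ (N : ℕ) (T_L T_R : ℝ), 0 < T_L → 0 < T_R → ∀ μ ν : Measure (PhaseSpace N),
      (pinnedChain ω₂ lam β γ).IsSteadyState N T_L T_R μ →
      (pinnedChain ω₂ lam β γ).IsSteadyState N T_L T_R ν → μ = ν) →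
    ∀ μ : (N : ℕ) → ℝ → ℝ → Measure (PhaseSpace N),
      (∀ (N : ℕ) (T_L T_R : ℝ), 0 < T_L → 0 < T_R →
        (pinnedChain ω₂ lam β γ).IsSteadyState N T_L T_R (μ N T_L T_R)) →
      ∀ T : ℝ, 0 < T → ∀ D : ℕ → ℝ,
        (∀ N : ℕ, Tendsto (fun δ : ℝ =>
            (pinnedChain ω₂ lam β γ).totalCurrent (μ N (T + δ / 2) (T - δ / 2)) / δ)
          (𝓝[≠] 0) (𝓝 (D N))) →
        (∀ N : ℕ, 2 ≤ N → 0 < D N) → P D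

/-- Resistance `R_N = (N-1)/D_N`. -/
def R (D : ℕ → ℝ) (N : ℕ) : ℝ := ((N : ℝ) - 1) / D N

/-- (A) for a sequence: bounded insertion cost. -/
def InsertionBounded (D : ℕ → ℝ) : Prop :=
  ∃ C : ℝ, ∀ N M : ℕ, 2 ≤ N → 2 ≤ M →
    ((N : ℝ) - 1) / D N + ((M : ℝ) - 1) / D M - C ≤ ((N : ℝ) + (M : ℝ) - 1) / D (N + M)

/-- Read-back: the crux is `Shell InsertionBounded` (definitional). -/
theorem crux_eq_shell :
    Summit.AtomisticToContinuum.FouriersLaw.Theses.JunctionLocality.SuperadditiveResistance ↔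
      Shell InsertionBounded :=
  Iff.rfl

/-! ## §1 STRENGTHEN — the rigid forms S⁺ and the (easy) implications down to (A) -/

/-- S⁺₁: two-sided junction locality of the resistance (the hypothesis shape of `JunctionDichotomy`). -/
def TwoSided (D : ℕ → ℝ) : Prop :=
  ∃ C : ℝ, ∀ N M : ℕ, 2 ≤ N → 2 ≤ M →
    |((N : ℝ) + (M : ℝ) - 1) / D (N + M) - ((N : ℝ) - 1) / D N - ((M : ℝ) - 1) / D M| ≤ C

/-- S⁺₂: bounded deviation from a linear law, `sup_N |R_N - ℓ N| < ∞` (single-sequence rigid form;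
equivalent to S⁺₁ by the proof of `JunctionDichotomy`, one direction below). -/
def BoundedAffineDeviation (D : ℕ → ℝ) : Prop :=
  ∃ ℓ B : ℝ, ∀ N : ℕ, 2 ≤ N → |((N : ℝ) - 1) / D N - ℓ * N| ≤ B

/-- S⁺₃: exponentially accurate affine law (the Gaussian-closed siblings: harmonic chain with
self-consistent reservoirs / velocity-flip proxy, where `R_N` is affine to `4e-8` for `N ≥ 12`). -/
def ExponentialAffineLaw (D : ℕ → ℝ) : Prop :=
  ∃ ℓ a K θ : ℝ, 0 ≤ θ ∧ θ < 1 ∧ ∀ N : ℕ, 2 ≤ N → |((N : ℝ) - 1) / D N - ℓ * N - a| ≤ K * θ ^ N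

theorem twoSided_insertionBounded {D : ℕ → ℝ} (h : TwoSided D) : InsertionBounded D := by
  obtain ⟨C, hC⟩ := h
  refine ⟨C, fun N M hN hM => ?_⟩
  have := (abs_le.mp (hC N M hN hM)).1
  linarith

theorem boundedAffine_twoSided {D : ℕ → ℝ} (h : BoundedAffineDeviation D) : TwoSided D := by
  obtain ⟨ℓ, B, hB⟩ := h
  refine ⟨3 * B, fun N M hN hM => ?_⟩
  have h1 := hB N hN
  have h2 := hB M hM
  have h3 := hB (N + M) (by omega)
  have hcast : ((N + M : ℕ) : ℝ) = (N : ℝ) + (M : ℝ) := by push_cast; ring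
  rw [hcast] at h3
  have e : ((N : ℝ) + (M : ℝ) - 1) / D (N + M) - ((N : ℝ) - 1) / D N - ((M : ℝ) - 1) / D M =
      (((N : ℝ) + (M : ℝ) - 1) / D (N + M) - ℓ * ((N : ℝ) + (M : ℝ))) -
        (((N : ℝ) - 1) / D N - ℓ * N) - (((M : ℝ) - 1) / D M - ℓ * M) := by ring
  rw [e]
  calc |(((N : ℝ) + (M : ℝ) - 1) / D (N + M) - ℓ * ((N : ℝ) + (M : ℝ))) -
        (((N : ℝ) - 1) / D N - ℓ * N) - (((M : ℝ) - 1) / D M - ℓ * M)|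
      ≤ |((N : ℝ) + (M : ℝ) - 1) / D (N + M) - ℓ * ((N : ℝ) + (M : ℝ))|
        + |((N : ℝ) - 1) / D N - ℓ * N| + |((M : ℝ) - 1) / D M - ℓ * M| := by
          refine (abs_sub _ _).trans ?_
          refine add_le_add ((abs_sub _ _).trans le_rfl) le_rfl
    _ ≤ B + B + B := by gcongr
    _ = 3 * B := by ring

theorem exponentialAffine_boundedAffine {D : ℕ → ℝ} (h : ExponentialAffineLaw D) :
    BoundedAffineDeviation D := by
  obtain ⟨ℓ, a, K, θ, hθ0, hθ1, hK⟩ := h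
  refine ⟨ℓ, |a| + |K|, fun N hN => ?_⟩
  have h1 := hK N hN
  have hθN : θ ^ N ≤ 1 := pow_le_one₀ hθ0 hθ1.le
  have hθN0 : 0 ≤ θ ^ N := pow_nonneg hθ0 N
  have hKθ : K * θ ^ N ≤ |K| := by
    calc K * θ ^ N ≤ |K| * θ ^ N := by gcongr; exact le_abs_self K
      _ ≤ |K| * 1 := by gcongr
      _ = |K| := by ring
  have e : ((N : ℝ) - 1) / D N - ℓ * N = (((N : ℝ) - 1) / D N - ℓ * N - a) + a := by ring
  rw [e]
  calc |(((N : ℝ) - 1) / D N - ℓ * N - a) + a| ≤ |((N : ℝ) - 1) / D N - ℓ * N - a| + |a| :=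
        abs_add_le _ _
    _ ≤ |K| + |a| := by linarith
    _ = |a| + |K| := by ring

/-- Every rigid form implies the crux's shell statement (monotonicity of `Shell`). -/
theorem shell_mono {P Q : (ℕ → ℝ) → Prop} (hPQ : ∀ D, P D → Q D) (h : Shell P) : Shell Q :=
  fun ω₂ lam β γ hω hl hβ hγ hU μ hμ T hT D hD hpos =>
    hPQ D (h ω₂ lam β γ hω hl hβ hγ hU μ hμ T hT D hD hpos)

theorem crux_of_twoSided (h : Shell TwoSided) :
    Summit.AtomisticToContinuum.FouriersLaw.Theses.JunctionLocality.SuperadditiveResistance :=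
  crux_eq_shell.mpr (shell_mono (fun _ => twoSided_insertionBounded) h)

theorem crux_of_boundedAffine (h : Shell BoundedAffineDeviation) :
    Summit.AtomisticToContinuum.FouriersLaw.Theses.JunctionLocality.SuperadditiveResistance :=
  crux_of_twoSided (shell_mono (fun _ => boundedAffine_twoSided) h)

theorem crux_of_exponentialAffine (h : Shell ExponentialAffineLaw) :
    Summit.AtomisticToContinuum.FouriersLaw.Theses.JunctionLocality.SuperadditiveResistance :=
  crux_of_boundedAffine (shell_mono (fun _ => exponentialAffine_boundedAffine) h)

/-! ## §2 DECOMPOSITION Σ_c — vanishing-noise regularisation (signatures only; NOT filed) -/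

/-- Weak steady state of the flip-noisy chain (generator `L + ε S_flip`), verbatim the predicate `S`
bound inline in `VanishingNoiseTransfer.NoiseLocality`; at `ε = 0` it is `IsSteadyState`. -/
def noisySteady (ω₂ lam β γ ε : ℝ) (N : ℕ) (T_L T_R : ℝ) (μ : Measure (PhaseSpace N)) : Prop :=
  IsProbabilityMeasure μ ∧
    (∀ f : PhaseSpace N → ℝ, ContDiff ℝ ((⊤ : ℕ∞) : WithTop ℕ∞) f → HasCompactSupport f →
      ∫ x, ((pinnedChain ω₂ lam β γ).generator N T_L T_R f x +
        ε * ∑ i : Fin N, (f (x.1, Function.update x.2 i (-x.2 i)) - f x)) ∂μ = 0) ∧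
    ∀ i : Fin N, Integrable ((pinnedChain ω₂ lam β γ).bondCurrent N i) μ

/-- Σ_c piece 1: the insertion bound for the flip-noisy chain with a constant UNIFORM in the flip
rate `ε ∈ (0, ε₁]` (response form; vacuity structure as in the crux).  This piece carries the whole
crux: ε-uniformity of `C` is the deterministic `1/N`-rate content (census §Decomposition). -/
def NoisyInsertionBoundUniform : Prop :=
  ∀ ω₂ lam β γ : ℝ, 0 < ω₂ → 0 < lam → 0 < β → 0 < γ → ∀ T : ℝ, 0 < T →
    ∃ C ε₁ : ℝ, 0 < ε₁ ∧ ∀ ε : ℝ, 0 < ε → ε ≤ ε₁ →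
      ∀ μ : (N : ℕ) → ℝ → ℝ → Measure (PhaseSpace N),
        (∀ (N : ℕ) (T_L T_R : ℝ), 0 < T_L → 0 < T_R →
          noisySteady ω₂ lam β γ ε N T_L T_R (μ N T_L T_R)) →
        ∀ D : ℕ → ℝ,
          (∀ N : ℕ, Tendsto (fun δ : ℝ =>
              (pinnedChain ω₂ lam β γ).totalCurrent (μ N (T + δ / 2) (T - δ / 2)) / δ)
            (𝓝[≠] 0) (𝓝 (D N))) →
          (∀ N : ℕ, 2 ≤ N → 0 < D N) →
          ∀ N M : ℕ, 2 ≤ N → 2 ≤ M →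
            ((N : ℝ) - 1) / D N + ((M : ℝ) - 1) / D M - C ≤ ((N : ℝ) + (M : ℝ) - 1) / D (N + M)

/-- Σ_c piece 2: FIXED-`N` continuity of the response coefficient in the flip rate at `ε = 0⁺`
(hypoelliptic perturbation theory at one length; fixed-`N` analysis, the kind the tree can do). -/
def FixedNNoiseContinuity : Prop :=
  ∀ ω₂ lam β γ : ℝ, 0 < ω₂ → 0 < lam → 0 < β → 0 < γ → ∀ T : ℝ, 0 < T → ∀ N : ℕ,
    ∀ μ0 : ℝ → ℝ → Measure (PhaseSpace N),
      (∀ T_L T_R : ℝ, 0 < T_L → 0 < T_R →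
        (pinnedChain ω₂ lam β γ).IsSteadyState N T_L T_R (μ0 T_L T_R)) →
      ∀ D0 : ℝ, Tendsto (fun δ : ℝ =>
          (pinnedChain ω₂ lam β γ).totalCurrent (μ0 (T + δ / 2) (T - δ / 2)) / δ) (𝓝[≠] 0) (𝓝 D0) →
      ∀ με : ℝ → ℝ → ℝ → Measure (PhaseSpace N),
        (∀ ε T_L T_R : ℝ, 0 < ε → 0 < T_L → 0 < T_R →
          noisySteady ω₂ lam β γ ε N T_L T_R (με ε T_L T_R)) →
        ∀ Dε : ℝ → ℝ,
          (∀ ε : ℝ, 0 < ε → Tendsto (fun δ : ℝ =>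
              (pinnedChain ω₂ lam β γ).totalCurrent (με ε (T + δ / 2) (T - δ / 2)) / δ)
            (𝓝[≠] 0) (𝓝 (Dε ε))) →
          Tendsto Dε (𝓝[>] 0) (𝓝 D0)

end Summit.AtomisticToContinuum.FouriersLaw.Cruxes.SuperadditiveResistance.StrategyCensus
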